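import Mathlib
import Summits.Ventures.HodgeRepro.OcticCMPointDualModel

/-!
# OcticCMPointDualSign — every conductor-`2` character at `𝔭₁, 𝔭₂ | 5` and its local root number

Blind re-derivation cell `pub-hodge-repro`, seat night-2 (gen 4).  Target tree path
`lean/Summits/Ventures/HodgeRepro/OcticCMPointDualSign.lean`.  Continues `OcticCMPointDualModel.lean`
(the ring `𝒪/𝔭² = k[ε]`, `k = 𝔽₅`, at the ramified places of the octic point).

* `exists_mulShift_eq` — every character of `(k, +)` is `x ↦ ψ₀(β x)` for a primitive `ψ₀` (injectivity of
  `β ↦ ψ₀(β ·)` plus Mathlib's count `|AddChar k ℂ| = |k|`, `AddChar.card_eq`);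
* `exists_tameWild` — **every character of `(𝒪/𝔭²)^×` is a `tameWild θ β ψ₀`** (tame part `θ(a) = χ(a)` on
  the Teichmüller lifts, wild part `χ(1 + bε) = ψ₀(β b)`), so the evaluation `gauss_tameWild` of the model
  file covers EVERY character; `tameWild_mul` / `tameWild_injective` — the parameters `(θ, β)` are unique and
  multiply (the transport of N2 `χ′₀χ′₁ = χ′₂χ′₃` to `θ₀θ₁ = θ₂θ₃`, `β₀ + β₁ = β₂ + β₃`);
* `theta_mul_self_of_conjDual` — conjugate duality `χ ∘ σ = χ⁻¹` forces `θ² = 1` on `k^×`;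
* **`eps_sign_of_conductor_two`** — for a conjugate-dual character `ω` of conductor exactly `2` at `𝔭 | 5`
  (`ω ∘ σ = ω⁻¹`, `ω` non-trivial on `1 + 𝔪`, `ω(ϖ)² = ω(−1)` for the trace-zero `ϖ`) and the `s = ½`
  constant `κ = |k|^{−1}`, even `n = ν + 2`: `ε(½, ω, ψ̃) = ω(ϖ)^n θ(β) ∈ {±1}` — Kudla Prop. 3.8 (ii)
  (`book:editornd-introduction-langlands-program` p0109:L3–L11) EVALUATED, with no model hypothesis left:
  this is (E2)'s local root number at the ramified places of the octic point at conductor `2`, in closed form;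
* `E3_conductor_two` — (E3) at `𝔭` for four conductor-`2` characters (ROUTE-B §9 (E3): `ε(χ′₀)ε(χ′₁) =
  ε(χ′₂)ε(χ′₃)`) is the explicit sign identity `ω₀(ϖ)^n ω₁(ϖ)^n θ₀(β₀) θ₁(β₁) = ω₂(ϖ)^n ω₃(ϖ)^n θ₂(β₂) θ₃(β₃)`;
* `primitive_tameWild` / `shallow_tameWild_tame` — gen 1's stability hypotheses (`Primitive`, `Shallow` of
  `PeriodCloserC7Stability.lean`) hold on the ring for the wild twist `1 + bε ↦ ψ₀(β b)` and the tame lines.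

**What this is not.**  The four `χ′_j` of the octic face are on no page: nothing is evaluated for a particular
face.  Conductors `c ≥ 3` at `𝔭 | 5` and the place `𝔮 | 2` are not covered.  Nothing here says anything about
the status of the Hodge conjecture for CM abelian varieties, which is NOT proved.
-/

set_option autoImplicit false

noncomputable section

open Finset TrivSqZeroExt

namespace Summit.Ventures.HodgeRepro.PeriodCloser

open GaussSumStability

namespace DualModel

variable {k : Type} [Field k]

/-! ### The characters of `(k, +)` and of `(𝒪/𝔭²)^×` -/

/-- `β ↦ ψ₀(β ·)` is injective for a primitive `ψ₀`. -/
theorem mulShift_injective (ψ₀ : AddChar k ℂ) (h₀ : ψ₀.IsPrimitive) :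
    Function.Injective (fun β : k => AddChar.mulShift ψ₀ β) := by
  intro a b hab
  have hab' : AddChar.mulShift ψ₀ a = AddChar.mulShift ψ₀ b := hab
  by_contra hne
  apply h₀ (sub_ne_zero.2 hne)
  have : AddChar.mulShift ψ₀ (a - b) = AddChar.mulShift ψ₀ a * AddChar.mulShift ψ₀ (-b) := by
    rw [AddChar.mulShift_mul, sub_eq_add_neg]
  rw [this, hab', AddChar.mulShift_mul, add_neg_cancel, AddChar.mulShift_zero]

/-- **Every character of `(k, +)` is `ψ₀(β ·)`** for a primitive `ψ₀`: `β ↦ ψ₀(β ·)` is injective between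
finite sets of the same size (`AddChar.card_eq`). -/
theorem exists_mulShift_eq [Fintype k] (ψ₀ : AddChar k ℂ) (h₀ : ψ₀.IsPrimitive) (χ : AddChar k ℂ) :
    ∃ β : k, χ = AddChar.mulShift ψ₀ β := by
  have hbij : Function.Bijective (fun β : k => AddChar.mulShift ψ₀ β) :=
    (Fintype.bijective_iff_injective_and_card _).2 ⟨mulShift_injective ψ₀ h₀, (AddChar.card_eq).symm⟩
  obtain ⟨β, hβ⟩ := hbij.2 χ
  exact ⟨β, hβ.symm⟩

/-- The tame part of a character `χ` of `k[ε]^×`: `a ↦ χ(a)` on the Teichmüller lifts `inl a`. -/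
def tamePart (χ : MulChar (DualNumber k) ℂ) : MulChar k ℂ where
  toFun a := χ (inl a)
  map_one' := by rw [inl_one, MulChar.map_one]
  map_mul' a b := by rw [inl_mul, map_mul]
  map_nonunit' a ha := by
    apply MulChar.map_nonunit
    rwa [isUnit_inl_iff]

/-- `tamePart χ a = χ (inl a)`. -/
theorem tamePart_apply (χ : MulChar (DualNumber k) ℂ) (a : k) : tamePart χ a = χ (inl a) := rfl

/-- `(1 + bε)(1 + dε) = 1 + (b + d)ε`: `1 + 𝔪 ≅ (k, +)`. -/
theorem one_add_inr_mul (b d : k) : (1 + inr b : DualNumber k) * (1 + inr d) = 1 + inr (b + d) := by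
  ext <;> simp [add_comm]

/-- The wild part of a character `χ` of `k[ε]^×`: `b ↦ χ(1 + bε)`, a character of `(k, +)` by
`one_add_inr_mul`. -/
def wildPart (χ : MulChar (DualNumber k) ℂ) : AddChar k ℂ where
  toFun b := χ (1 + inr b)
  map_zero_eq_one' := by rw [inr_zero, add_zero, MulChar.map_one]
  map_add_eq_mul' b d := by rw [← map_mul, one_add_inr_mul]

/-- `wildPart χ b = χ (1 + bε)`. -/
theorem wildPart_apply (χ : MulChar (DualNumber k) ℂ) (b : k) : wildPart χ b = χ (1 + inr b) := rfl

/-- `a + bε = a · (1 + (b/a)ε)` for `a ≠ 0`. -/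
theorem eq_inl_mul_one_add_inr (x : DualNumber k) (hx : x.fst ≠ 0) :
    x = inl x.fst * (1 + inr (x.snd / x.fst)) := by
  ext
  · rw [fst_mul, fst_inl, fst_add, fst_one, fst_inr, add_zero, mul_one]
  · rw [DualNumber.snd_mul, fst_inl, snd_inl, snd_add, snd_one, snd_inr, zero_add, zero_mul, add_zero,
      mul_div_cancel₀ _ hx]

/-- **Every character of `(𝒪/𝔭²)^×` is a `tameWild θ β ψ₀`** (for a primitive `ψ₀`): `θ = tamePart χ`, and
`β` is given by `exists_mulShift_eq` applied to `wildPart χ`. -/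
theorem exists_tameWild [DecidableEq k] [Fintype k] (ψ₀ : AddChar k ℂ) (h₀ : ψ₀.IsPrimitive)
    (χ : MulChar (DualNumber k) ℂ) : ∃ β : k, χ = tameWild (tamePart χ) β ψ₀ := by
  obtain ⟨β, hβ⟩ := exists_mulShift_eq ψ₀ h₀ (wildPart χ)
  refine ⟨β, MulChar.ext fun x => ?_⟩
  have hx : (x : DualNumber k).fst ≠ 0 := isUnit_iff_ne_zero.1 (isUnit_iff_isUnit_fst.1 x.isUnit)
  rw [tameWild_apply, if_neg hx, tamePart_apply]
  have hw : χ (1 + inr ((x : DualNumber k).snd / (x : DualNumber k).fst)) =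
      ψ₀ (β * ((x : DualNumber k).snd / (x : DualNumber k).fst)) := by
    have := DFunLike.congr_fun hβ ((x : DualNumber k).snd / (x : DualNumber k).fst)
    rwa [wildPart_apply, AddChar.mulShift_apply] at this
  rw [mul_div_assoc, ← hw, ← map_mul, ← eq_inl_mul_one_add_inr (x : DualNumber k) hx]

/-- **The parameters multiply**: `tameWild θ β ψ₀ · tameWild θ' β' ψ₀ = tameWild (θ θ') (β + β') ψ₀` — the
transport of N2 (`χ′₀χ′₁ = χ′₂χ′₃`) to the parameters. -/
theorem tameWild_mul [DecidableEq k] (θ θ' : MulChar k ℂ) (β β' : k) (ψ₀ : AddChar k ℂ) :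
    tameWild θ β ψ₀ * tameWild θ' β' ψ₀ = tameWild (θ * θ') (β + β') ψ₀ := by
  refine MulChar.ext fun x => ?_
  have hx : (x : DualNumber k).fst ≠ 0 := isUnit_iff_ne_zero.1 (isUnit_iff_isUnit_fst.1 x.isUnit)
  rw [MulChar.coeToFun_mul, Pi.mul_apply, tameWild_apply, tameWild_apply, tameWild_apply, if_neg hx,
    if_neg hx, if_neg hx, MulChar.coeToFun_mul, Pi.mul_apply, add_mul, add_div, AddChar.map_add_eq_mul]
  ring

/-- **The parameters are unique** (for a primitive `ψ₀`): `tameWild θ β ψ₀ = tameWild θ' β' ψ₀` forces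
`θ = θ'` (evaluate on `inl a`) and `β = β'` (evaluate on `1 + bε`, then `mulShift_injective`). -/
theorem tameWild_injective [DecidableEq k] (ψ₀ : AddChar k ℂ) (h₀ : ψ₀.IsPrimitive) (θ θ' : MulChar k ℂ)
    (β β' : k) (h : tameWild θ β ψ₀ = tameWild θ' β' ψ₀) : θ = θ' ∧ β = β' := by
  constructor
  · refine MulChar.ext fun a => ?_
    have := congrArg (fun χ : MulChar (DualNumber k) ℂ => χ (inl (a : k))) h
    simpa only [tameWild_inl] using this
  · apply mulShift_injective ψ₀ h₀
    ext b
    have := congrArg (fun χ : MulChar (DualNumber k) ℂ => χ (1 + inr b)) h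
    simpa only [tameWild_one_add_inr, AddChar.mulShift_apply] using this

/-! ### Conjugate duality and the sign -/

/-- **Conjugate duality forces a quadratic-or-trivial tame part**: if `χ ∘ σ = χ⁻¹` then `θ(a)² = 1` for
`a ≠ 0` (`σ` fixes `inl a`, so `θ(a) = θ(a)^{−1}`). -/
theorem theta_mul_self_of_conjDual (χ : MulChar (DualNumber k) ℂ) (hσ : ∀ x, χ (conj k x) = χ⁻¹ x) (a : k)
    (ha : a ≠ 0) : tamePart χ a * tamePart χ a = 1 := by
  have h := hσ (inl a)
  rw [conj_inl, MulChar.inv_apply_eq_inv'] at h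
  have hne : χ (inl a) ≠ 0 := by
    intro h0
    have := MulChar.map_nonunit χ (a := inl a)
    have hu : IsUnit (inl a : DualNumber k) := by rw [isUnit_inl_iff]; exact isUnit_iff_ne_zero.2 ha
    have h1 : χ (inl a) * χ ((inl a : DualNumber k)⁻¹) = 1 := by
      rw [← map_mul]
      rw [TrivSqZeroExt.mul_inv_cancel (by rw [fst_inl]; exact ha), MulChar.map_one]
    rw [h0, zero_mul] at h1
    exact zero_ne_one h1
  rw [tamePart_apply]
  calc χ (inl a) * χ (inl a) = χ (inl a) * (χ (inl a))⁻¹ := by rw [← h]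
    _ = 1 := mul_inv_cancel₀ hne

/-- `ε` of a character whose unit part is a `tameWild θ β ψ₀` (the model file's `eps_tameWild` read off the
unit part). -/
theorem eps_of_unit_eq [DecidableEq k] [Fintype k] (κ : ℂ) (n : ℕ) (ω : LocalChar (DualNumber k))
    (θ : MulChar k ℂ) (β : k) (hβ : β ≠ 0) (ψ₀ : AddChar k ℂ) (h₀ : ψ₀.IsPrimitive)
    (hω : ω.unit = tameWild θ β ψ₀) :
    LocalChar.eps κ n ω (psiTilde ψ₀) = ω.piVal ^ n * κ * ((Fintype.card k : ℂ) * (θ β)⁻¹) := by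
  unfold LocalChar.eps LocalChar.gauss
  rw [hω, gaussSum_tameWild_inv θ β hβ ψ₀ h₀]

/-- **The local root number of a conjugate-dual character of conductor exactly `2` at `𝔭₁, 𝔭₂ | 5`, in
closed form** — Kudla Prop. 3.8 (ii) on the model with every hypothesis intrinsic to `ω`: conjugate duality
`ω ∘ σ = ω⁻¹`, non-triviality on `1 + 𝔪` (conductor exactly `2`), `ω(ϖ)² = ω(−1)` (the trace-zero
uniformiser `σ ϖ = −ϖ`), even `n = ν + 2`, and the `s = ½` constant `κ |k| = 1`.  Then, with `ω = tameWild θ β ψ₀`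
(`β ≠ 0`, `θ(β)² = 1`): `ε(½, ω, ψ̃) = ω(ϖ)^n · θ(β) ∈ {1, −1}`. -/
theorem eps_sign_of_conductor_two [DecidableEq k] [Fintype k] (ω : LocalChar (DualNumber k))
    (ψ₀ : AddChar k ℂ) (h₀ : ψ₀.IsPrimitive)
    (hcond : ∃ z₀ ∈ maxIdeal k, ω.unit (1 + z₀) ≠ 1) (hσω : ∀ x, ω.unit (conj k x) = ω.unit⁻¹ x)
    (hπ2 : ω.piVal ^ 2 = ω.unit (-1)) (n : ℕ) (hn : Even n) (κ : ℂ) (hκ : κ * (Fintype.card k : ℂ) = 1) :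
    ∃ θ : MulChar k ℂ, ∃ β : k, β ≠ 0 ∧ ω.unit = tameWild θ β ψ₀ ∧ θ β * θ β = 1 ∧
      LocalChar.eps κ n ω (psiTilde ψ₀) = ω.piVal ^ n * θ β ∧
      (LocalChar.eps κ n ω (psiTilde ψ₀) = 1 ∨ LocalChar.eps κ n ω (psiTilde ψ₀) = -1) := by
  obtain ⟨β, hβ⟩ := exists_tameWild ψ₀ h₀ ω.unit
  set θ := tamePart ω.unit with hθdef
  -- `β ≠ 0`: conductor exactly `2`
  have hβ0 : β ≠ 0 := by
    rintro rfl
    obtain ⟨z₀, hz₀, hne⟩ := hcond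
    apply hne
    rw [hβ, tameWild_apply, fst_add, fst_one, (mem_maxIdeal_iff z₀).1 hz₀, add_zero]
    simp only [one_ne_zero, if_false, zero_mul, zero_div, AddChar.map_zero_eq_one, MulChar.map_one, mul_one]
  -- `θ(β)² = 1`: conjugate duality
  have hθβ : θ β * θ β = 1 := theta_mul_self_of_conjDual ω.unit hσω β hβ0
  have hθβ' : (θ β)⁻¹ = θ β := inv_eq_of_mul_eq_one_right hθβ
  -- the value
  have hval : LocalChar.eps κ n ω (psiTilde ψ₀) = ω.piVal ^ n * θ β := by
    rw [eps_of_unit_eq κ n ω θ β hβ0 ψ₀ h₀ hβ, hθβ']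
    calc ω.piVal ^ n * κ * ((Fintype.card k : ℂ) * θ β) = ω.piVal ^ n * (κ * (Fintype.card k : ℂ)) * θ β := by
          ring
      _ = ω.piVal ^ n * θ β := by rw [hκ, mul_one]
  refine ⟨θ, β, hβ0, hβ, hθβ, hval, ?_⟩
  -- `ω(ϖ)^n = ±1` for even `n`: `ω(ϖ)² = ω(−1) = θ(−1)`, `θ(−1)² = 1`
  have hm1 : θ (-1) * θ (-1) = 1 := theta_mul_self_of_conjDual ω.unit hσω (-1) (neg_ne_zero.2 one_ne_zero)
  have hπ : ω.piVal ^ n = 1 ∨ ω.piVal ^ n = -1 := by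
    obtain ⟨m, hm⟩ := hn
    have hneg : ω.unit (-1) = θ (-1) := by rw [hβ, tameWild_neg_one]
    rw [hm, ← two_mul, pow_mul, hπ2, hneg]
    rcases mul_self_eq_one_iff.1 hm1 with h1 | h1
    · left; rw [h1, one_pow]
    · rw [h1]; exact neg_one_pow_eq_or ℂ m
  rw [hval]
  rcases hπ with h | h <;> rcases mul_self_eq_one_iff.1 hθβ with h1 | h1
  · left; rw [h, h1, one_mul]
  · right; rw [h, h1, one_mul]
  · right; rw [h, h1, neg_one_mul]
  · left; rw [h, h1, neg_one_mul, neg_neg]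

/-- **(E3) at `𝔭 | 5` for four conductor-`2` characters is an explicit sign identity**: with
`ω_j = ⟨tameWild θ_j β_j ψ₀, ϖ_j⟩`, `β_j ≠ 0`, and `κ |k| = 1`,
`ε(ω₀)ε(ω₁) = ε(ω₂)ε(ω₃) ↔ ϖ₀^n ϖ₁^n θ₀(β₀)^{−1} θ₁(β₁)^{−1} = ϖ₂^n ϖ₃^n θ₂(β₂)^{−1} θ₃(β₃)^{−1}`
(ROUTE-B §9 (E3): `ε_v(χ′₀)ε_v(χ′₁) = ε_v(χ′₂)ε_v(χ′₃)`). -/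
theorem E3_conductor_two [DecidableEq k] [Fintype k] (κ : ℂ) (hκ : κ * (Fintype.card k : ℂ) = 1) (n : ℕ)
    (ψ₀ : AddChar k ℂ)
    (h₀ : ψ₀.IsPrimitive) (θ : Fin 4 → MulChar k ℂ) (β : Fin 4 → k) (hβ : ∀ j, β j ≠ 0) (ϖ : Fin 4 → ℂ) :
    (LocalChar.eps κ n (⟨tameWild (θ 0) (β 0) ψ₀, ϖ 0⟩ : LocalChar (DualNumber k)) (psiTilde ψ₀) *
        LocalChar.eps κ n (⟨tameWild (θ 1) (β 1) ψ₀, ϖ 1⟩ : LocalChar (DualNumber k)) (psiTilde ψ₀) =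
      LocalChar.eps κ n (⟨tameWild (θ 2) (β 2) ψ₀, ϖ 2⟩ : LocalChar (DualNumber k)) (psiTilde ψ₀) *
        LocalChar.eps κ n (⟨tameWild (θ 3) (β 3) ψ₀, ϖ 3⟩ : LocalChar (DualNumber k)) (psiTilde ψ₀)) ↔
    ϖ 0 ^ n * ϖ 1 ^ n * ((θ 0 (β 0))⁻¹ * (θ 1 (β 1))⁻¹) =
      ϖ 2 ^ n * ϖ 3 ^ n * ((θ 2 (β 2))⁻¹ * (θ 3 (β 3))⁻¹) := by
  have hval : ∀ j : Fin 4, LocalChar.eps κ n (⟨tameWild (θ j) (β j) ψ₀, ϖ j⟩ : LocalChar (DualNumber k))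
      (psiTilde ψ₀) = ϖ j ^ n * (θ j (β j))⁻¹ := by
    intro j
    rw [eps_tameWild κ n (θ j) (β j) (hβ j) ψ₀ h₀ (ϖ j)]
    calc ϖ j ^ n * κ * ((Fintype.card k : ℂ) * (θ j (β j))⁻¹) =
        ϖ j ^ n * (κ * (Fintype.card k : ℂ)) * (θ j (β j))⁻¹ := by ring
      _ = ϖ j ^ n * (θ j (β j))⁻¹ := by rw [hκ, mul_one]
  rw [hval 0, hval 1, hval 2, hval 3]
  constructor <;> intro h <;> linear_combination h

/-! ### Gen 1's stability hypotheses instantiated at `c = 2` -/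

/-- **The wild character `1 + bε ↦ ψ₀(β b)` is a primitive twist in gen 1's sense** (`Primitive ψ̃ 𝔪 ρ a`,
`PeriodCloserC7Stability.lean`): `ρ(1 + z) = ψ̃(a z)` on `𝔪` with `a = β` (a unit for `β ≠ 0`) — the twist of
conductor exactly `2` at `𝔭 | 5` exists on the ring, with any `ϖ`-value. -/
theorem primitive_tameWild [DecidableEq k] (β : k) (hβ : β ≠ 0) (ψ₀ : AddChar k ℂ) (piVal : ℂ) :
    LocalChar.Primitive (psiTilde ψ₀) (maxIdeal k) (⟨tameWild 1 β ψ₀, piVal⟩ : LocalChar (DualNumber k))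
      (isUnit_inl_iff.2 (isUnit_iff_ne_zero.2 hβ)).unit := by
  intro z hz
  rw [mem_maxIdeal_iff] at hz
  have hz' : z = inr z.snd := by ext <;> simp [hz]
  change tameWild 1 β ψ₀ (1 + z) = psiTilde ψ₀ (inl β * z)
  rw [hz', tameWild_one_add_inr, psiTilde_apply, DualNumber.snd_mul, fst_inl, snd_inl, snd_inr, fst_inr,
    mul_zero, add_zero]

/-- **The tame characters are shallow in gen 1's sense** (`Shallow ψ̃ 𝔪 χ`: trivial on the units `≡ 1` modulo
the annihilator of `𝔪`, i.e. `χ(u) = 1` when `u − 1 ∈ 𝔪`): `tameWild θ 0 ψ₀` is one, as conductor `≤ 1`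
requires. -/
theorem shallow_tameWild_tame [DecidableEq k] (θ : MulChar k ℂ) (ψ₀ : AddChar k ℂ) (h₀ : ψ₀.IsPrimitive)
    (piVal : ℂ) :
    LocalChar.Shallow (psiTilde ψ₀) (maxIdeal k) (⟨tameWild θ 0 ψ₀, piVal⟩ : LocalChar (DualNumber k)) := by
  intro u hu
  have h1 : ((u : DualNumber k) - 1).fst = 0 := (mem_maxIdeal_iff _).1 ((psiAnn_iff ψ₀ h₀ _).1 hu)
  rw [fst_sub, fst_one, sub_eq_zero] at h1
  change tameWild θ 0 ψ₀ (u : DualNumber k) = 1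
  rw [tameWild_apply, if_neg (by rw [h1]; exact one_ne_zero), h1, zero_mul, zero_div,
    AddChar.map_zero_eq_one, MulChar.map_one, mul_one]

/-- **The twisted tame lines at conductor `2`** (the analogue of `eps_tame_twist_four`): gen 1's stability
`eps_mul_eq` on `I = 𝔪` with the primitive wild twist `ρ = ⟨tameWild 1 β ψ₀, ρ(ϖ)⟩` (`a = β`) and a shallow tame
line `χ = ⟨tameWild θ 0 ψ₀, χ(ϖ)⟩` gives `ε(χρ) = χ(ϖ)^n θ(β)^{−1} · ε(ρ)`, and `ε(ρ) = ρ(ϖ)^n` for `κ |k| = 1`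
(`eps_tameWild` with `θ = 1`): `ε(½, χρ, ψ̃) = (χ(ϖ) ρ(ϖ))^n · θ(β)^{−1}`. -/
theorem eps_tame_twist_two [DecidableEq k] [Fintype k] (ψ₀ : AddChar k ℂ) (h₀ : ψ₀.IsPrimitive) (κ : ℂ)
    (hκ : κ * (Fintype.card k : ℂ) = 1) (n : ℕ) (θ : MulChar k ℂ) (β : k) (hβ : β ≠ 0) (πχ π : ℂ) :
    LocalChar.eps κ n ((⟨tameWild θ 0 ψ₀, πχ⟩ : LocalChar (DualNumber k)) * ⟨tameWild 1 β ψ₀, π⟩) (psiTilde ψ₀) =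
      (πχ * π) ^ n * (θ β)⁻¹ := by
  have hρ := primitive_tameWild β hβ ψ₀ π
  rw [LocalChar.eps_mul_eq κ n _ _ (psiTilde ψ₀) (maxIdeal k) hI _ hρ (shallow_tameWild_tame θ ψ₀ h₀ πχ),
    eps_tameWild κ n 1 β hβ ψ₀ h₀ π, LocalChar.cRho, IsUnit.unit_spec, tameWild_inl]
  have h1 : ((1 : MulChar k ℂ) β) = 1 := MulChar.one_apply (isUnit_iff_ne_zero.2 hβ)
  rw [h1, inv_one, mul_one]
  calc πχ ^ n * (θ β)⁻¹ * (π ^ n * κ * (Fintype.card k : ℂ)) =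
      (πχ * π) ^ n * (θ β)⁻¹ * (κ * (Fintype.card k : ℂ)) := by ring
    _ = (πχ * π) ^ n * (θ β)⁻¹ := by rw [hκ, mul_one]

/-! ### Conjugate-symplectic characters of conductor `2`: the sign is a Legendre symbol -/

/-- **The conjugate-symplectic condition on the model, tame part**: the route's `χ′_j` satisfy
`χ′|_{k_v^×} = ω_{K_v/k_v}` (TP1 p0019:L3, ROUTE-B §9 (E1)/(E2)); at a ramified place with `q` odd the
norm-residue character `ω_{K_v/k_v}` restricted to the units is the quadratic character of the residue field
(standard local class field theory — NOT on a held page, hence a DEFINITION here): on the Teichmüller lifts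
`inl a` the character is `quadChar k a`. -/
def ConjSymplecticTame [Fintype k] [DecidableEq k] (ω : LocalChar (DualNumber k)) : Prop :=
  ∀ a : k, ω.unit (inl a) = ((quadraticChar k).ringHomComp (Int.castRingHom ℂ)) a

/-- For `ω = tameWild θ β ψ₀`, `ConjSymplecticTame` says `θ = χ_quad`. -/
theorem tamePart_eq_quadChar_of_conjSymplectic [Fintype k] [DecidableEq k] (ω : LocalChar (DualNumber k))
    (h : ConjSymplecticTame ω) : tamePart ω.unit = (quadraticChar k).ringHomComp (Int.castRingHom ℂ) := by
  refine MulChar.ext fun a => ?_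
  rw [tamePart_apply, h]

/-- **(E2) at `𝔭₁, 𝔭₂ | 5` for a conjugate-symplectic character of conductor exactly `2`, in numbers**:
`ε(½, ω, ψ_δ) = ω(ϖ)^n · χ_quad(β)` — the local root number is `ω(ϖ)^n` times the Legendre symbol of the
wild parameter `β` (`ω(1 + bε) = ψ₀(β b)`). -/
theorem eps_conjSymplectic_conductor_two [DecidableEq k] [Fintype k] (ω : LocalChar (DualNumber k))
    (ψ₀ : AddChar k ℂ) (h₀ : ψ₀.IsPrimitive) (hcond : ∃ z₀ ∈ maxIdeal k, ω.unit (1 + z₀) ≠ 1)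
    (hσω : ∀ x, ω.unit (conj k x) = ω.unit⁻¹ x) (hπ2 : ω.piVal ^ 2 = ω.unit (-1)) (hcs : ConjSymplecticTame ω)
    (n : ℕ) (hn : Even n) (κ : ℂ) (hκ : κ * (Fintype.card k : ℂ) = 1) :
    ∃ β : k, β ≠ 0 ∧ ω.unit = tameWild ((quadraticChar k).ringHomComp (Int.castRingHom ℂ)) β ψ₀ ∧
      LocalChar.eps κ n ω (psiTilde ψ₀) =
        ω.piVal ^ n * ((quadraticChar k).ringHomComp (Int.castRingHom ℂ)) β := by
  obtain ⟨θ, β, hβ, hω, -, hval, -⟩ := eps_sign_of_conductor_two ω ψ₀ h₀ hcond hσω hπ2 n hn κ hκ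
  have hθ : θ = (quadraticChar k).ringHomComp (Int.castRingHom ℂ) := by
    rw [← tamePart_eq_quadChar_of_conjSymplectic ω hcs]
    obtain ⟨β', hβ'⟩ := exists_tameWild ψ₀ h₀ ω.unit
    exact (tameWild_injective ψ₀ h₀ θ (tamePart ω.unit) β β' (hω.symm.trans hβ')).1
  exact ⟨β, hβ, hθ ▸ hω, hθ ▸ hval⟩

/-- **(E2) at `𝔭₁, 𝔭₂ | 5` is solvable for either sign** (ROUTE-B §9.9 (c), the free choice of the line
class): the norm-residue symbol on the Teichmüller units is the Legendre symbol of `𝔽₅`, which takes both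
values — `χ_quad(1) = 1`, `χ_quad(2) = −1` — so for every sign `s` there is a unit class `a` with
`ω_v(a) = s`. -/
theorem E2_solvable_p5 (s : ℤ) (hs : s = 1 ∨ s = -1) : ∃ a : ZMod 5, a ≠ 0 ∧ quadraticChar (ZMod 5) a = s := by
  rcases hs with rfl | rfl
  · exact ⟨1, one_ne_zero, by decide⟩
  · exact ⟨2, by decide, by decide⟩

/-- **(E3) at a place of `S₃` of a face from the conductor-`2` model** (gen 1's `E3At_of_model` with `hρ`, `hχ`
discharged by `primitive_tameWild` / `shallow_tameWild_tame`): if the face's four local signs at `v` are the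
model's ε-factors of the tame lines `⟨tameWild θ_j 0 ψ₀, π_j⟩` twisted by the wild `⟨tameWild 1 β ψ₀, π⟩`
(`β ≠ 0`) and N2 holds, then `E3At I v d`; the identification `he` is the only input left. -/
theorem E3At_of_tameWild {L : Type} [Field L] [NumberField L] [NumberField.IsCMField L] [DecidableEq k]
    [Fintype k] (I : C7Face L) (v : I.Place) (d : I.Datum) (ψ₀ : AddChar k ℂ) (h₀ : ψ₀.IsPrimitive) (κ : ℂ)
    (n : ℕ) (θ : Fin 4 → MulChar k ℂ) (π' : Fin 4 → ℂ) (β : k) (hβ : β ≠ 0) (π : ℂ)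
    (hN2 : (⟨tameWild (θ 0) 0 ψ₀, π' 0⟩ : LocalChar (DualNumber k)) * ⟨tameWild (θ 1) 0 ψ₀, π' 1⟩ =
      (⟨tameWild (θ 2) 0 ψ₀, π' 2⟩ : LocalChar (DualNumber k)) * ⟨tameWild (θ 3) 0 ψ₀, π' 3⟩)
    (he : ∀ j, ((I.localRootNumber v (I.chars d j) : ℤ) : ℂ) =
      LocalChar.eps κ n ((⟨tameWild (θ j) 0 ψ₀, π' j⟩ : LocalChar (DualNumber k)) * ⟨tameWild 1 β ψ₀, π⟩)
        (psiTilde ψ₀)) :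
    E3At I v d :=
  E3At_of_model I v d κ n (fun j => ⟨tameWild (θ j) 0 ψ₀, π' j⟩) _ (psiTilde ψ₀) (maxIdeal k) hI _
    (primitive_tameWild β hβ ψ₀ π) (fun j => shallow_tameWild_tame (θ j) ψ₀ h₀ (π' j)) hN2 he

/-! ### Why the route twists: (E3) for the UNTWISTED conductor-`2` characters is a Legendre condition -/

/-- **(E3) for four conjugate-symplectic conductor-`2` characters, untwisted**: with the tame parts all equal to
`χ_quad`, the `ϖ`-part of N2 (`π₀ π₁ = π₂ π₃`) and `κ |k| = 1`, the identity `ε(χ′₀)ε(χ′₁) = ε(χ′₂)ε(χ′₃)` holds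
iff `χ_quad(β₀ β₁) = χ_quad(β₂ β₃)` — a Legendre condition on the wild parameters, NOT a consequence of N2
(`β₀ + β₁ = β₂ + β₃`): see `E3_untwisted_fails_p5`.  The route twists by a deep `ρ` precisely so that (E3)
becomes the `ϖ`-part of N2 (`E3_tame_twist_four`, `OcticCMPointTruncFour.lean`). -/
theorem E3_conductor_two_quad [DecidableEq k] [Fintype k] (κ : ℂ) (hκ : κ * (Fintype.card k : ℂ) = 1) (n : ℕ)
    (ψ₀ : AddChar k ℂ) (h₀ : ψ₀.IsPrimitive) (β : Fin 4 → k) (hβ : ∀ j, β j ≠ 0) (π : Fin 4 → ℂ)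
    (hN2 : π 0 * π 1 = π 2 * π 3) :
    (LocalChar.eps κ n (⟨tameWild ((quadraticChar k).ringHomComp (Int.castRingHom ℂ)) (β 0) ψ₀, π 0⟩ :
          LocalChar (DualNumber k)) (psiTilde ψ₀) *
        LocalChar.eps κ n (⟨tameWild ((quadraticChar k).ringHomComp (Int.castRingHom ℂ)) (β 1) ψ₀, π 1⟩ :
          LocalChar (DualNumber k)) (psiTilde ψ₀) =
      LocalChar.eps κ n (⟨tameWild ((quadraticChar k).ringHomComp (Int.castRingHom ℂ)) (β 2) ψ₀, π 2⟩ :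
          LocalChar (DualNumber k)) (psiTilde ψ₀) *
        LocalChar.eps κ n (⟨tameWild ((quadraticChar k).ringHomComp (Int.castRingHom ℂ)) (β 3) ψ₀, π 3⟩ :
          LocalChar (DualNumber k)) (psiTilde ψ₀)) ↔
    (π 0 * π 1) ^ n * (((quadraticChar k).ringHomComp (Int.castRingHom ℂ)) (β 0 * β 1))⁻¹ =
      (π 0 * π 1) ^ n * (((quadraticChar k).ringHomComp (Int.castRingHom ℂ)) (β 2 * β 3))⁻¹ := by
  rw [E3_conductor_two κ hκ n ψ₀ h₀ (fun _ => (quadraticChar k).ringHomComp (Int.castRingHom ℂ)) β hβ π,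
    map_mul, map_mul, mul_inv, mul_inv]
  constructor
  · intro h
    calc (π 0 * π 1) ^ n * ((((quadraticChar k).ringHomComp (Int.castRingHom ℂ)) (β 0))⁻¹ *
          (((quadraticChar k).ringHomComp (Int.castRingHom ℂ)) (β 1))⁻¹) =
        π 0 ^ n * π 1 ^ n * ((((quadraticChar k).ringHomComp (Int.castRingHom ℂ)) (β 0))⁻¹ *
          (((quadraticChar k).ringHomComp (Int.castRingHom ℂ)) (β 1))⁻¹) := by rw [mul_pow]
      _ = π 2 ^ n * π 3 ^ n * ((((quadraticChar k).ringHomComp (Int.castRingHom ℂ)) (β 2))⁻¹ *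
          (((quadraticChar k).ringHomComp (Int.castRingHom ℂ)) (β 3))⁻¹) := h
      _ = _ := by rw [← mul_pow, ← hN2]
  · intro h
    calc π 0 ^ n * π 1 ^ n * ((((quadraticChar k).ringHomComp (Int.castRingHom ℂ)) (β 0))⁻¹ *
          (((quadraticChar k).ringHomComp (Int.castRingHom ℂ)) (β 1))⁻¹) =
        (π 0 * π 1) ^ n * ((((quadraticChar k).ringHomComp (Int.castRingHom ℂ)) (β 0))⁻¹ *
          (((quadraticChar k).ringHomComp (Int.castRingHom ℂ)) (β 1))⁻¹) := by rw [mul_pow]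
      _ = (π 0 * π 1) ^ n * ((((quadraticChar k).ringHomComp (Int.castRingHom ℂ)) (β 2))⁻¹ *
          (((quadraticChar k).ringHomComp (Int.castRingHom ℂ)) (β 3))⁻¹) := h
      _ = _ := by rw [hN2, mul_pow]

/-- **The untwisted (E3) can fail at `𝔭 | 5` although N2 holds**: `β = (1, 3, 2, 2)` has `β₀ + β₁ = β₂ + β₃`
(the wild part of N2) but `χ_quad(1 · 3) = −1 ≠ 1 = χ_quad(2 · 2)`. -/
theorem E3_untwisted_fails_p5 :
    (1 : ZMod 5) + 3 = 2 + 2 ∧ quadraticChar (ZMod 5) (1 * 3) ≠ quadraticChar (ZMod 5) (2 * 2) := by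
  exact ⟨by decide, by decide⟩

end DualModel

end Summit.Ventures.HodgeRepro.PeriodCloser

end
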